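import Literature.AnabelianGeometry.EtaleTheta.Discharge.Sec2Prop22iiInversionCoset
import Literature.AnabelianGeometry.EtaleTheta.Discharge.Sec2Prop22InvThetaOfInvEll
import Literature.AnabelianGeometry.EtaleTheta.Discharge.Sec2Def23OfSplitting
import Literature.AnabelianGeometry.EtaleTheta.Discharge.Sec2Prop22EigenQuotient
import HarnessLib

/-!
# [EtTh] Proposition 2.2 (i), (ii), (iii) — NODE CLOSERS: each item as ONE theorem in print's shape,
# over every `CoverDataAx` and AT THE ARITHMETIC MODEL (`ThetaSetting.PiCData.coverDataAx`)

S. Mochizuki, *The étale theta function and its Frobenioid-theoretic manifestations*, Publ. RIMS **45**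
(2009) [EtTh], §2, Prop. 2.2 "(The Inversion Automorphism)", PRIMS PDF p. 37 l. 5 – p. 38 l. 12 (printed
pp. 263–264; kurims-ms p. 34) [cite: MochizukiEtTh2009, Prop 2.2 p.37]:

> "Suppose that `l` is odd. Then: (i) The conjugation action of `ι̲` on the rank two `(ℤ/lℤ)`-module `Δ̄_{X̲}`
> determines a direct product decomposition `Δ̄_{X̲} ≅ Δ̄^ell_{X̲} × Δ̄_Θ` into eigenspaces, with eigenvalues
> `−1` and `1`, respectively, that is compatible with the conjugation action of `Π̄_{X̲}`. Denote by
> `s_ι : Δ̄^ell_{X̲} → Δ̄_{X̲}` the resulting splitting. (ii) `Im(s_ι) ⊆ Π̄_{X̲}` is normal and induces an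
> isomorphism `D̄_x ⥲ Π̄_{X̲}/Im(s_ι)` over `G_K`. In particular, any section of the
> `H¹(G_K, Δ_Θ) ≅ K^×/(K^×)^l`-torsor of splittings of `D_x ↠ G_K` determines a covering `X̲̲^log → X̲^log`
> whose geometric portion `Δ_{X̲̲}` maps isomorphically onto `Δ̄^ell_{X̲}` [hence is cyclic of order `l`];
> `Δ̄_{X̲̲} = Im(s_ι)`, `Δ̄_{X̲} = Δ̄_{X̲̲}·Δ̄_Θ`. Finally, the image of `ι̲` in `Δ̄_C/Δ̄_{X̲}` is the unique coset
> that lifts the nontrivial element of `Gal(X/C)` and normalizes `Δ̄_{X̲̲}`. (iii) There exists a unique coset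
> `∈ Δ̄_{C̲}/Δ̄_{X̲̲}` such that `ι̲` has order `2` iff it belongs to this coset. If we choose `ι̲` of order `2`,
> the open subgroup generated by `Π̄_{X̲̲}` and `ι̲` in `Π̄_{C̲}` determines a double covering `X̲̲^log → C̲̲^log`
> — a hyperbolic orbicurve — that fits into a cartesian diagram with `X̲^log → C̲^log`."

Proof-only companion (theorems only: no `def`, no `Prop` fact, no instance, no notation; abc-iut cell, layer
L2, cone nodes **`EtTh:Prop2.2(i)`, `EtTh:Prop2.2(ii)`, `EtTh:Prop2.2(iii)`**, holder abc-iut-w6-d082 gen 3;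
R-C «per-node clause coverage», the pattern of `Sec3Thm37iNode` / `Sec3Thm37iiNode`).  Nothing landed is edited
or restated: every clause-level closer already exists — (i) `CoverDataAx.prop22_i_holds` (abc-iut-L2-t10,
`Sec2InversionProofs` p406577); (ii) `Dx_sup_eigen_eq` / `Dx_inf_eigen_le` / `splitting_sup_eigen_inf_deltaC`
(`Sec2SplittingProofs` p407272), `CoverData.relIndex_barKer_eigen` / `relIndex_eigen_deltaXu` (abc-iut-w6-d082 g2,
p431949), `isCyclic_eigen_quot_odd` (p435688), `CoverData.index_typeLTorsTheta` (Rmk. 2.3.1, `ThetaCovers`),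
the last sentence `normalizer_eigen_eq` / `mem_normalizer_eigen_iff_of_lift` (abc-iut-w6-d082 g3, p454441);
(iii) `exists_inversion_sq_mem_barKer` (p407272), `sup_zpowers_inf_eq` / `relIndex_sup_zpowers`
(`Sec2DoubleCoverProofs` p407791), openness `isOpen_splitting_sup_eigen_sup_zpowers` (`Sec2Def23OfSplitting`
p428319).  THIS FILE assembles them, per item, into ONE signature whose antecedents are print's own ("Suppose
that `l` is odd" = field `l_odd`; `Π_{C̲} = H'` of type `(1, l-tors)±`, an inversion `ι̲`, and — for (ii)/(iii) —
the datum `E = Im(s_ι)` of (i) and a splitting `S` of `D̄_x ↠ G_K`), so that each node's residual is read off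
one signature:

* §1 over EVERY `X : CoverDataAx l` (abc-iut-L2-t2's interface + the two printed ι-eigen laws):
  `prop22_i_node`, `prop22_ii_node (hΘ)`, `prop22_iii_node` — the only binder beyond the interface is `hΘ :
  ⁅Δ_X, Δ_X⁆·Ker = Δ̄_Θ`-preimage (the printed DEFINITION `Δ_Θ := [Δ^Θ_X, Δ^Θ_X]`, p. 35; GAP-LEDGER G-L2d3-1),
  used ONLY by the last sentence of (ii) and necessary there in substance (at the abelian-`Δ̄_X` witness every
  element of `Δ_X` normalises `E`: `ThetaCoversAbelianWitnessInversionCoset`, p455769); `prop22_ii_node_core`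
  is (ii) without its last sentence and without `hΘ`.
* §2 AT THE ARITHMETIC MODEL: for the `CoverDataAx` of an [EtTh] §1 theta setting (abc-iut-L2-t10's
  `PiCData.coverDataAx`, `ThetaCoversAxOfSetting` p428054) `prop22_i_node_ofSetting`, `prop22_ii_node_ofSetting`,
  `prop22_iii_node_ofSetting` with `hΘ` DISCHARGED (abc-iut-L2-t11's `coverDataAx_hTheta`, p431249) and the
  P-C4 binder `hιtheta` DISCHARGED from `hιell` (abc-iut-L6-d6's `PiCData.inv_theta_of_inv_ell`, p422670):
  residual = exactly the binders of `coverDataAx` itself — the input bundle `I : D.PiCData PiC` (G-L2t10-2,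
  CLOSED as a construction by abc-iut-L2-d3's `MuTwoSetting.CLevelData.piCDataOf`), `e : OncePuncturedData`, a
  cusp `x`, P-C3 `hIx` (G-L2t10-3) and P-C4(a) `hιell` (G-L2t10-4).

Vocabulary note (as in the interface, `ThetaCovers.lean`): subgroups of the quotients `Π̄_•`, `Δ̄_•` are carried
as their inverse images in `Π_C`, so "`Δ_{X̲̲} ⥲ Δ̄^ell_{X̲}`, cyclic of order `l`" reads `E·Δ̄_Θ`-preimage `= Δ_{X̲}`,
`E ∩ Δ̄_Θ`-preimage `= Ker`, `[E : Ker] = l`, `E = ⟨g⟩·Ker` (the quotient-type forms `E/Ker ≃* Δ_{X̲}/Δ̄_Θ`,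
`IsCyclic (E/Ker)` are `CoverData.nonempty_eigenQuot_mulEquiv` / `isCyclic_eigen_quot_odd`, p435688, used in
the proof); the `K^×/(K^×)^l`-torsor structure on the splittings (Kummer theory) is not typed by the interface
and is the EDGE to [GalSect] §4 (`TemperedCurve.cuspTorsorH1`, p432116), not a clause proved here.

HONEST FRAMING: refereed pre-IUT material; bookkeeping over PROVED rows, no new mathematics; nothing asserts that
a `CoverDataAx` or a theta setting exists (the interface is inhabited for every odd `l`:
`ThetaCoversHeisenbergWitness`; the arithmetic input bundle by `MuTwoSetting.CLevelData.piCDataOf`); no side is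
taken on [IUTchIII] Cor. 3.12; no statement of [EtTh] is strengthened; typed ≠ proved elsewhere.
-/

namespace Literature.AnabelianGeometry.EtaleTheta

namespace ThetaCovers

namespace CoverDataAx

open scoped commutatorElement

universe u

variable {l : ℕ} (X : CoverDataAx.{u} l)

/-! ### §1 The three items in print's shape, over every `CoverDataAx` -/

/-- **[EtTh] Prop. 2.2 (i) — the node in print's shape**: for `l` odd (field `l_odd`), `Π_{C̲} = H'` of type
`(1, l-tors)±` and an inversion `ι̲ ∈ Δ_{C̲}`, the conjugation action of `ι̲` on `Δ̄_{X̲}` determines a UNIQUE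
direct product decomposition `Δ̄_{X̲} = E·Δ̄_Θ`, `E ∩ Δ̄_Θ = 1` (mod `Ker`) into the `(−1)`-eigenspace `E = Im(s_ι)`
and the `(+1)`-eigenspace `Δ̄_Θ`, compatible with `Π_{X̲}`-conjugation (all packaged in `IsMinusEigen`).
= abc-iut-L2-t10's `prop22_i_holds` (p406577) at `Π_{X̲} := Π_{C̲} ∩ Π_X`. [cite: MochizukiEtTh2009, Prop 2.2(i) p.37] -/
theorem prop22_i_node {H' : Subgroup X.PiC} {ι : X.PiC} (hH' : X.toCoverData.IsTypeLTorsPm H')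
    (hι : X.toCoverData.IsInversion H' ι) :
    ∃! E : Subgroup X.PiC, X.toCoverData.IsMinusEigen (H' ⊓ X.PiX) H' ι E :=
  X.prop22_i_holds (H' ⊓ X.PiX) H' ι hH' rfl hι

/-- `E = Im(s_ι)` is cyclic modulo `Ker`: `E = ⟨g⟩·Ker` for some `g ∈ E` (from `isCyclic_eigen_quot_odd`, p435688).
[cite: MochizukiEtTh2009, Prop 2.2(ii) p.37] -/
theorem exists_zpowers_sup_barKer_eq_eigen {H' E : Subgroup X.PiC} {ι : X.PiC}
    (hH' : X.toCoverData.IsTypeLTorsPm H') (hE : X.toCoverData.IsMinusEigen (H' ⊓ X.PiX) H' ι E) :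
    ∃ g ∈ E, Subgroup.zpowers g ⊔ X.barKer = E := by
  haveI := X.toCoverData.normal_barKer_subgroupOf E
  haveI := X.toCoverData.isCyclic_eigen_quot_odd hH' rfl hE
  obtain ⟨q, hq⟩ := IsCyclic.exists_generator (α := ↥E ⧸ X.barKer.subgroupOf E)
  induction q using QuotientGroup.induction_on with
  | H g =>
    refine ⟨g, g.2, le_antisymm (sup_le ((Subgroup.zpowers_le (G := X.PiC)).2 g.2) hE.barKer_le) fun e he => ?_⟩
    obtain ⟨k, hk⟩ := hq (QuotientGroup.mk ⟨e, he⟩)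
    have hk' : QuotientGroup.mk (s := X.barKer.subgroupOf E) (g ^ k) = QuotientGroup.mk ⟨e, he⟩ := by
      rw [QuotientGroup.mk_zpow]; exact hk
    rw [QuotientGroup.eq, Subgroup.mem_subgroupOf, Subgroup.coe_mul, Subgroup.coe_inv,
      Subgroup.coe_zpow] at hk'
    have : (e : X.PiC) = (g : X.PiC) ^ k * (((g : X.PiC) ^ k)⁻¹ * e) := by group
    rw [this]
    exact Subgroup.mul_mem _ (Subgroup.mem_sup_left (Subgroup.zpow_mem_zpowers _ _))
      (Subgroup.mem_sup_right hk')

/-- **[EtTh] Prop. 2.2 (ii) without its last sentence — the node core, NO binder beyond the interface**: for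
`Π_{C̲} = H'` of type `(1, l-tors)±`, an inversion `ι̲` and the `(−1)`-eigenspace datum `E = Im(s_ι)` of (i):
(A) `Im(s_ι) ⊆ Π_{X̲}` is normal, and `D_x → Π_{X̲}/Im(s_ι)` is surjective (`D_x·E = Π_{X̲}`) and injective
(`D_x ∩ E ⊆ Ker`) — an isomorphism over `G_K`; (B) ANY splitting `S` of `D̄_x ↠ G_K` determines the covering
`X̲̲ → X̲`: `Π_{X̲̲} := S·E ⊆ Π_{X̲}` is of type `(1, l-torsΘ)` (Def. 2.3) of index `l` (Rmk. 2.3.1), whose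
geometric portion is `Δ_{X̲̲} = Π_{X̲̲} ∩ Δ_C = E = Im(s_ι)`; (C) `E` maps isomorphically onto `Δ̄^ell_{X̲}`
(`E·Δ̄_Θ`-preimage `= Δ_{X̲}`, `E ∩ Δ̄_Θ`-preimage `= Ker`), hence is cyclic of order `l` (`[E : Ker] = l`,
`E = ⟨g⟩·Ker`), and `Δ̄_{X̲} = Δ̄_{X̲̲}·Δ̄_Θ` with `[Δ_{X̲} : E] = l`.
[cite: MochizukiEtTh2009, Prop 2.2(ii) p.37] -/
theorem prop22_ii_node_core {H' E : Subgroup X.PiC} {ι : X.PiC} (hH' : X.toCoverData.IsTypeLTorsPm H')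
    (hι : X.toCoverData.IsInversion H' ι) (hE : X.toCoverData.IsMinusEigen (H' ⊓ X.PiX) H' ι E) :
    -- (A) `Im(s_ι)` normal in `Π_{X̲}`; `D̄_x ⥲ Π̄_{X̲}/Im(s_ι)`
    ((∀ g ∈ H' ⊓ X.PiX, ∀ e ∈ E, g * e * g⁻¹ ∈ E) ∧ X.Dx ⊔ E = H' ⊓ X.PiX ∧ X.Dx ⊓ E ≤ X.barKer) ∧
    -- (B) every splitting `S` of `D̄_x ↠ G_K` determines `X̲̲ → X̲` with `Δ_{X̲̲} = Im(s_ι)`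
    (∀ S : Subgroup X.PiC, X.toCoverData.IsSplitting S →
      X.toCoverData.IsTypeLTorsTheta (S ⊔ E) ∧ S ⊔ E ≤ H' ⊓ X.PiX ∧ (S ⊔ E).relIndex (H' ⊓ X.PiX) = l ∧
        (S ⊔ E) ⊓ X.DeltaC = E) ∧
    -- (C) `Δ_{X̲̲} ⥲ Δ̄^ell_{X̲}`, cyclic of order `l`; `Δ̄_{X̲} = Δ̄_{X̲̲}·Δ̄_Θ`
    (E ⊔ X.barTheta = (H' ⊓ X.PiX) ⊓ X.DeltaC ∧ E ⊓ X.barTheta = X.barKer ∧ X.barKer.relIndex E = l ∧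
      (∃ g ∈ E, Subgroup.zpowers g ⊔ X.barKer = E) ∧ E.relIndex ((H' ⊓ X.PiX) ⊓ X.DeltaC) = l) := by
  refine ⟨⟨hE.conj_mem, X.Dx_sup_eigen_eq hH' rfl hE, X.Dx_inf_eigen_le hE⟩, fun S hS => ?_,
    ⟨hE.sup_eq, hE.inf_eq, X.toCoverData.relIndex_barKer_eigen hH' rfl hE,
      X.exists_zpowers_sup_barKer_eq_eigen hH' hE, X.toCoverData.relIndex_eigen_deltaXu hE⟩⟩
  exact ⟨⟨⟨H', E, S, ι, hH', hι, hE, hS, rfl⟩⟩, X.splitting_sup_eigen_le hH' hE hS,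
    X.index_typeLTorsTheta H' E S ι hH' hE hS, X.splitting_sup_eigen_inf_deltaC hH' rfl hE hS⟩

/-- **[EtTh] Prop. 2.2 (ii) — the node in print's shape, ALL sentences**: (A)(B)(C) of `prop22_ii_node_core`
AND (D) the last sentence: the normaliser of `Δ̄_{X̲̲} = Im(s_ι)` in `Π_C` is exactly `Π_{C̲}`, and among the lifts
`g ∈ Δ_C ∖ Δ_X` of the nontrivial element of `Gal(X/C) = Δ̄_C/Δ̄_X` those normalising `Δ̄_{X̲̲}` are exactly the
coset `ι̲·Δ̄_{X̲}` (`g` normalises `E` iff `ι̲⁻¹ g ∈ Δ_{X̲}`) — under the printed definition of `Δ̄_Θ` (`hΘ`,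
G-L2d3-1; abc-iut-w6-d082's `normalizer_eigen_eq` / `mem_normalizer_eigen_iff_of_lift`, p454441).
Residual beyond the interface: {`hΘ`}. [cite: MochizukiEtTh2009, Prop 2.2(ii) p.37] -/
theorem prop22_ii_node (hΘ : ⁅X.DeltaX, X.DeltaX⁆ ⊔ X.barKer = X.barTheta) {H' E : Subgroup X.PiC}
    {ι : X.PiC} (hH' : X.toCoverData.IsTypeLTorsPm H') (hι : X.toCoverData.IsInversion H' ι)
    (hE : X.toCoverData.IsMinusEigen (H' ⊓ X.PiX) H' ι E) :
    (((∀ g ∈ H' ⊓ X.PiX, ∀ e ∈ E, g * e * g⁻¹ ∈ E) ∧ X.Dx ⊔ E = H' ⊓ X.PiX ∧ X.Dx ⊓ E ≤ X.barKer) ∧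
      (∀ S : Subgroup X.PiC, X.toCoverData.IsSplitting S →
        X.toCoverData.IsTypeLTorsTheta (S ⊔ E) ∧ S ⊔ E ≤ H' ⊓ X.PiX ∧ (S ⊔ E).relIndex (H' ⊓ X.PiX) = l ∧
          (S ⊔ E) ⊓ X.DeltaC = E) ∧
      (E ⊔ X.barTheta = (H' ⊓ X.PiX) ⊓ X.DeltaC ∧ E ⊓ X.barTheta = X.barKer ∧ X.barKer.relIndex E = l ∧
        (∃ g ∈ E, Subgroup.zpowers g ⊔ X.barKer = E) ∧ E.relIndex ((H' ⊓ X.PiX) ⊓ X.DeltaC) = l)) ∧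
    -- (D) the last sentence
    (Subgroup.normalizer ((E : Subgroup X.PiC) : Set X.PiC) = H' ∧
      ∀ g : X.PiC, g ∈ X.DeltaC → g ∉ X.PiX →
        (g ∈ Subgroup.normalizer ((E : Subgroup X.PiC) : Set X.PiC) ↔ ι⁻¹ * g ∈ (H' ⊓ X.PiX) ⊓ X.DeltaC)) :=
  ⟨X.prop22_ii_node_core hH' hι hE,
    ⟨X.normalizer_eigen_eq hΘ hH' hι hE, fun _ hgC hgX => X.mem_normalizer_eigen_iff_of_lift hΘ hH' hι hE hgC hgX⟩⟩

/-- **[EtTh] Prop. 2.2 (iii) — the node in print's shape**: for `Π_{C̲} = H'` of type `(1, l-tors)±`, an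
inversion `ι̲`, its eigenspace datum `E = Im(s_ι) = Δ_{X̲̲}` and a splitting `S` (so `Π_{X̲̲} = S·E`): (A) there is
a unique coset of `Δ̄_{X̲̲}` in `Δ̄_{C̲}` consisting of the inversions of order `2` (order read in `Δ̄_{C̲}`: `ι̲₁² ∈ Ker
↔ ι̲₀⁻¹ ι̲₁ ∈ E`); (B) if `ι̲` has order `2`, then `Π_{C̲̲} := ⟨Π_{X̲̲}, ι̲⟩ ⊆ Π_{C̲}` is of type `(1, l-torsΘ)±`
(Def. 2.3), `X̲̲ → C̲̲` is a double covering (`[Π_{C̲̲} : Π_{X̲̲}] = 2`) fitting into a cartesian diagram with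
`X̲ → C̲` (`Π_{C̲̲} ∩ Π_{X̲} = Π_{X̲̲}`, indeed `Π_{C̲̲} ∩ Π_X = Π_{X̲̲}`).  Composition of `exists_inversion_sq_mem_barKer`
(p407272), `relIndex_sup_zpowers` / `sup_zpowers_inf_eq` (p407791).  No binder beyond the interface.
[cite: MochizukiEtTh2009, Prop 2.2(iii) p.37] -/
theorem prop22_iii_node {H' E S : Subgroup X.PiC} {ι : X.PiC} (hH' : X.toCoverData.IsTypeLTorsPm H')
    (hι : X.toCoverData.IsInversion H' ι) (hE : X.toCoverData.IsMinusEigen (H' ⊓ X.PiX) H' ι E)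
    (hS : X.toCoverData.IsSplitting S) :
    -- (A) the coset of order-`2` inversions
    (∃ ι₀ : X.PiC, X.toCoverData.IsInversion H' ι₀ ∧ ι₀ * ι₀ ∈ X.barKer ∧
      ∀ ι₁ : X.PiC, X.toCoverData.IsInversion H' ι₁ → (ι₁ * ι₁ ∈ X.barKer ↔ ι₀⁻¹ * ι₁ ∈ E)) ∧
    -- (B) for `ι̲` of order `2`: `C̲̲`, the double covering `X̲̲ → C̲̲`, the cartesian diagram
    (ι * ι ∈ X.barKer →
      X.toCoverData.IsTypeLTorsThetaPm ((S ⊔ E) ⊔ Subgroup.zpowers ι) ∧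
      (S ⊔ E) ⊔ Subgroup.zpowers ι ≤ H' ∧
      (S ⊔ E).relIndex ((S ⊔ E) ⊔ Subgroup.zpowers ι) = 2 ∧
      ((S ⊔ E) ⊔ Subgroup.zpowers ι) ⊓ (H' ⊓ X.PiX) = S ⊔ E ∧
      ((S ⊔ E) ⊔ Subgroup.zpowers ι) ⊓ X.PiX = S ⊔ E) := by
  refine ⟨X.exists_inversion_sq_mem_barKer hH' rfl hι hE, fun h2 => ?_⟩
  have hle : (S ⊔ E) ⊔ Subgroup.zpowers ι ≤ H' :=
    sup_le ((X.splitting_sup_eigen_le hH' hE hS).trans inf_le_left) ((Subgroup.zpowers_le (G := X.PiC)).2 hι.mem)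
  have hcart := X.sup_zpowers_inf_eq hH' rfl hι hE hS h2
  refine ⟨⟨⟨H', E, S, ι, hH', hι, h2, hE, hS, rfl⟩⟩, hle, X.relIndex_sup_zpowers hH' rfl hι hE hS h2, hcart, ?_⟩
  exact le_antisymm (fun g hg => hcart.le ⟨hg.1, hle hg.1, hg.2⟩)
    (le_inf le_sup_left ((X.splitting_sup_eigen_le hH' hE hS).trans inf_le_right))

/-- **Prop. 2.2 (iii), "the OPEN subgroup generated by `Π̄_{X̲̲}` and `ι̲`"** over a compact `Π_C` (the profinite
`Π_C` of print): if the chosen splitting `S` is closed then `Π_{C̲̲} = S·E·⟨ι̲⟩` is open (abc-iut's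
`isOpen_splitting_sup_eigen_sup_zpowers`, p428319). [cite: MochizukiEtTh2009, Prop 2.2(iii) p.37] -/
theorem prop22_iii_node_isOpen [CompactSpace X.PiC] {H' E S : Subgroup X.PiC} {ι : X.PiC}
    (hH' : X.toCoverData.IsTypeLTorsPm H') (hE : X.toCoverData.IsMinusEigen (H' ⊓ X.PiX) H' ι E)
    (hS : X.toCoverData.IsSplitting S) (hSc : IsClosed (S : Set X.PiC)) :
    IsOpen (((S ⊔ E) ⊔ Subgroup.zpowers ι : Subgroup X.PiC) : Set X.PiC) :=
  X.isOpen_splitting_sup_eigen_sup_zpowers hH' hE hS hSc ι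

/-- **The three items at once** (for the layer certificate): over every `CoverDataAx`, given the printed definition
of `Δ̄_Θ` (`hΘ`), for all `(Π_{C̲}, ι̲)` the eigenspace datum of (i) exists uniquely and every such datum with
every splitting satisfies (ii) [all sentences] and (iii). [cite: MochizukiEtTh2009, Prop 2.2 p.37] -/
theorem prop22_node (hΘ : ⁅X.DeltaX, X.DeltaX⁆ ⊔ X.barKer = X.barTheta) {H' : Subgroup X.PiC} {ι : X.PiC}
    (hH' : X.toCoverData.IsTypeLTorsPm H') (hι : X.toCoverData.IsInversion H' ι) :
    (∃! E : Subgroup X.PiC, X.toCoverData.IsMinusEigen (H' ⊓ X.PiX) H' ι E) ∧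
    ∀ E S : Subgroup X.PiC, X.toCoverData.IsMinusEigen (H' ⊓ X.PiX) H' ι E → X.toCoverData.IsSplitting S →
      ((X.Dx ⊔ E = H' ⊓ X.PiX ∧ X.Dx ⊓ E ≤ X.barKer ∧ (S ⊔ E) ⊓ X.DeltaC = E ∧
          X.toCoverData.IsTypeLTorsTheta (S ⊔ E) ∧ X.barKer.relIndex E = l ∧
          Subgroup.normalizer ((E : Subgroup X.PiC) : Set X.PiC) = H') ∧
        ((∃ ι₀ : X.PiC, X.toCoverData.IsInversion H' ι₀ ∧ ι₀ * ι₀ ∈ X.barKer ∧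
            ∀ ι₁ : X.PiC, X.toCoverData.IsInversion H' ι₁ → (ι₁ * ι₁ ∈ X.barKer ↔ ι₀⁻¹ * ι₁ ∈ E)) ∧
          (ι * ι ∈ X.barKer → X.toCoverData.IsTypeLTorsThetaPm ((S ⊔ E) ⊔ Subgroup.zpowers ι) ∧
            (S ⊔ E).relIndex ((S ⊔ E) ⊔ Subgroup.zpowers ι) = 2 ∧
            ((S ⊔ E) ⊔ Subgroup.zpowers ι) ⊓ (H' ⊓ X.PiX) = S ⊔ E))) := by
  refine ⟨X.prop22_i_node hH' hι, fun E S hE hS => ?_⟩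
  obtain ⟨⟨⟨-, hA2, hA3⟩, hB, ⟨-, -, hC3, -, -⟩⟩, hD1, -⟩ := X.prop22_ii_node hΘ hH' hι hE
  obtain ⟨hB1, -, -, hB4⟩ := hB S hS
  obtain ⟨hiiiA, hiiiB⟩ := X.prop22_iii_node hH' hι hE hS
  exact ⟨⟨hA2, hA3, hB4, hB1, hC3, hD1⟩, hiiiA, fun h2 =>
    let h := hiiiB h2; ⟨h.1, h.2.2.1, h.2.2.2.1⟩⟩

end CoverDataAx

end ThetaCovers

/-! ### §2 At the arithmetic model (abc-iut-L2-t10's `PiCData.coverDataAx`): `hΘ` and `hιtheta` DISCHARGED -/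

namespace ThetaSetting

namespace PiCData

open Literature.AnabelianGeometry.SemiGraphs ThetaCovers

open scoped commutatorElement

variable {p : ℕ} [Fact p.Prime] {D : ThetaSetting p} {PiC : Type} [Group PiC] [TopologicalSpace PiC]
  [IsTopologicalGroup PiC] [T2Space PiC] (I : D.PiCData PiC) (l : ℕ)

/-- **[EtTh] Prop. 2.2 (i) AT THE ARITHMETIC MODEL**: for the `CoverDataAx` of an [EtTh] §1 theta setting — input
bundle `I`, `e`, a cusp `x`, `l` odd, P-C3 `hIx`, P-C4(a) `hιell` (the `Δ̄_Θ`-clause `hιtheta` being DERIVED,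
`inv_theta_of_inv_ell`) — and every `Π_{C̲} = H'` of type `(1, l-tors)±` with inversion `ι̲`: the `(−1)`-eigenspace
datum `E = Im(s_ι)` exists uniquely. [cite: MochizukiEtTh2009, Prop 2.2(i) p.37] -/
theorem prop22_i_node_ofSetting (e : D.OncePuncturedData) {x : D.Pt} (hx : D.IsCusp x) (hodd : Odd l)
    (hIx : (I.Dx x ⊓ I.augGK.ker) ⊔ I.barKer l = I.barTheta l)
    (hιell : ∀ c ∈ I.augGK.ker, c ∉ I.PiX → ∀ d ∈ I.PiX ⊓ I.augGK.ker, c * d * c⁻¹ * d ∈ I.barTheta l)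
    {H' : Subgroup (I.coverDataAx l e hx hodd hIx hιell (I.inv_theta_of_inv_ell l e hιell)).PiC}
    {ι : (I.coverDataAx l e hx hodd hIx hιell (I.inv_theta_of_inv_ell l e hιell)).PiC}
    (hH' : (I.coverDataAx l e hx hodd hIx hιell (I.inv_theta_of_inv_ell l e hιell)).toCoverData.IsTypeLTorsPm H')
    (hι : (I.coverDataAx l e hx hodd hIx hιell (I.inv_theta_of_inv_ell l e hιell)).toCoverData.IsInversion H' ι) :
    ∃! E, (I.coverDataAx l e hx hodd hIx hιell (I.inv_theta_of_inv_ell l e hιell)).toCoverData.IsMinusEigen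
      (H' ⊓ (I.coverDataAx l e hx hodd hIx hιell (I.inv_theta_of_inv_ell l e hιell)).PiX) H' ι E :=
  (I.coverDataAx l e hx hodd hIx hιell (I.inv_theta_of_inv_ell l e hιell)).prop22_i_node hH' hι

/-- **[EtTh] Prop. 2.2 (ii), ALL SENTENCES, AT THE ARITHMETIC MODEL** — `CoverDataAx.prop22_ii_node` for
`PiCData.coverDataAx` with the printed definition of `Δ̄_Θ` a THEOREM there (`coverDataAx_hTheta`, p431249) and
`hιtheta` derived from `hιell` (`inv_theta_of_inv_ell`, p422670): NO binder beyond those of `coverDataAx`.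
[cite: MochizukiEtTh2009, Prop 2.2(ii) p.37] -/
theorem prop22_ii_node_ofSetting (e : D.OncePuncturedData) {x : D.Pt} (hx : D.IsCusp x) (hodd : Odd l)
    (hIx : (I.Dx x ⊓ I.augGK.ker) ⊔ I.barKer l = I.barTheta l)
    (hιell : ∀ c ∈ I.augGK.ker, c ∉ I.PiX → ∀ d ∈ I.PiX ⊓ I.augGK.ker, c * d * c⁻¹ * d ∈ I.barTheta l)
    {H' E : Subgroup (I.coverDataAx l e hx hodd hIx hιell (I.inv_theta_of_inv_ell l e hιell)).PiC}
    {ι : (I.coverDataAx l e hx hodd hIx hιell (I.inv_theta_of_inv_ell l e hιell)).PiC}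
    (hH' : (I.coverDataAx l e hx hodd hIx hιell (I.inv_theta_of_inv_ell l e hιell)).toCoverData.IsTypeLTorsPm H')
    (hι : (I.coverDataAx l e hx hodd hIx hιell (I.inv_theta_of_inv_ell l e hιell)).toCoverData.IsInversion H' ι)
    (hE : (I.coverDataAx l e hx hodd hIx hιell (I.inv_theta_of_inv_ell l e hιell)).toCoverData.IsMinusEigen
      (H' ⊓ (I.coverDataAx l e hx hodd hIx hιell (I.inv_theta_of_inv_ell l e hιell)).PiX) H' ι E) :
    let X := I.coverDataAx l e hx hodd hIx hιell (I.inv_theta_of_inv_ell l e hιell)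
    (((∀ g ∈ H' ⊓ X.PiX, ∀ e ∈ E, g * e * g⁻¹ ∈ E) ∧ X.Dx ⊔ E = H' ⊓ X.PiX ∧ X.Dx ⊓ E ≤ X.barKer) ∧
      (∀ S : Subgroup X.PiC, X.toCoverData.IsSplitting S →
        X.toCoverData.IsTypeLTorsTheta (S ⊔ E) ∧ S ⊔ E ≤ H' ⊓ X.PiX ∧ (S ⊔ E).relIndex (H' ⊓ X.PiX) = l ∧
          (S ⊔ E) ⊓ X.toCoverData.DeltaC = E) ∧
      (E ⊔ X.barTheta = (H' ⊓ X.PiX) ⊓ X.toCoverData.DeltaC ∧ E ⊓ X.barTheta = X.barKer ∧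
        X.barKer.relIndex E = l ∧ (∃ g ∈ E, Subgroup.zpowers g ⊔ X.barKer = E) ∧
        E.relIndex ((H' ⊓ X.PiX) ⊓ X.toCoverData.DeltaC) = l)) ∧
    (Subgroup.normalizer ((E : Subgroup X.PiC) : Set X.PiC) = H' ∧
      ∀ g : X.PiC, g ∈ X.toCoverData.DeltaC → g ∉ X.PiX →
        (g ∈ Subgroup.normalizer ((E : Subgroup X.PiC) : Set X.PiC) ↔
          ι⁻¹ * g ∈ (H' ⊓ X.PiX) ⊓ X.toCoverData.DeltaC)) :=
  (I.coverDataAx l e hx hodd hIx hιell (I.inv_theta_of_inv_ell l e hιell)).prop22_ii_node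
    (I.coverDataAx_hTheta l e hx hodd hIx hιell (I.inv_theta_of_inv_ell l e hιell)) hH' hι hE

/-- **[EtTh] Prop. 2.2 (iii) AT THE ARITHMETIC MODEL** — `CoverDataAx.prop22_iii_node` for `PiCData.coverDataAx`
(`hιtheta` derived from `hιell`): NO binder beyond those of `coverDataAx`.
[cite: MochizukiEtTh2009, Prop 2.2(iii) p.37] -/
theorem prop22_iii_node_ofSetting (e : D.OncePuncturedData) {x : D.Pt} (hx : D.IsCusp x) (hodd : Odd l)
    (hIx : (I.Dx x ⊓ I.augGK.ker) ⊔ I.barKer l = I.barTheta l)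
    (hιell : ∀ c ∈ I.augGK.ker, c ∉ I.PiX → ∀ d ∈ I.PiX ⊓ I.augGK.ker, c * d * c⁻¹ * d ∈ I.barTheta l)
    {H' E S : Subgroup (I.coverDataAx l e hx hodd hIx hιell (I.inv_theta_of_inv_ell l e hιell)).PiC}
    {ι : (I.coverDataAx l e hx hodd hIx hιell (I.inv_theta_of_inv_ell l e hιell)).PiC}
    (hH' : (I.coverDataAx l e hx hodd hIx hιell (I.inv_theta_of_inv_ell l e hιell)).toCoverData.IsTypeLTorsPm H')
    (hι : (I.coverDataAx l e hx hodd hIx hιell (I.inv_theta_of_inv_ell l e hιell)).toCoverData.IsInversion H' ι)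
    (hE : (I.coverDataAx l e hx hodd hIx hιell (I.inv_theta_of_inv_ell l e hιell)).toCoverData.IsMinusEigen
      (H' ⊓ (I.coverDataAx l e hx hodd hIx hιell (I.inv_theta_of_inv_ell l e hιell)).PiX) H' ι E)
    (hS : (I.coverDataAx l e hx hodd hIx hιell (I.inv_theta_of_inv_ell l e hιell)).toCoverData.IsSplitting S) :
    let X := I.coverDataAx l e hx hodd hIx hιell (I.inv_theta_of_inv_ell l e hιell)
    (∃ ι₀ : X.PiC, X.toCoverData.IsInversion H' ι₀ ∧ ι₀ * ι₀ ∈ X.barKer ∧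
      ∀ ι₁ : X.PiC, X.toCoverData.IsInversion H' ι₁ → (ι₁ * ι₁ ∈ X.barKer ↔ ι₀⁻¹ * ι₁ ∈ E)) ∧
    (ι * ι ∈ X.barKer →
      X.toCoverData.IsTypeLTorsThetaPm ((S ⊔ E) ⊔ Subgroup.zpowers ι) ∧
      (S ⊔ E) ⊔ Subgroup.zpowers ι ≤ H' ∧
      (S ⊔ E).relIndex ((S ⊔ E) ⊔ Subgroup.zpowers ι) = 2 ∧
      ((S ⊔ E) ⊔ Subgroup.zpowers ι) ⊓ (H' ⊓ X.PiX) = S ⊔ E ∧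
      ((S ⊔ E) ⊔ Subgroup.zpowers ι) ⊓ X.PiX = S ⊔ E) :=
  (I.coverDataAx l e hx hodd hIx hιell (I.inv_theta_of_inv_ell l e hιell)).prop22_iii_node hH' hι hE hS

end PiCData

end ThetaSetting

end Literature.AnabelianGeometry.EtaleTheta
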